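import Summits.ABC.IUTFork.Cor312SettingPrVol
import Summits.ABC.IUTFork.Cor312PilotIdelesDH
import HarnessLib

/-!
# [IUTchIII] Corollary 3.12 over the REAL log-shells with the PACKET-NORMALISED verbatim volumes — the Dupuy–Hilado
# PILOT REGIONS READ OFF IDELES (sharp reading): `hθ`, `hfinθ`, `hq`, `hfin` PROVED, the setting `settingPrVolSharp`,
# `BridgeHyps ⟸ ThetaFinite`, and the local log-volumes in CLOSED FORM `Σ_{v⃗} Pr(v⃗)·log ‖t_{v_j}‖`

Record file (D-0012) of the abc-iut cell (Cor. 3.12 sub-crew, seat abc-iut-c312-7, gen 3; D-0067 TEAM A row A-0 coda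
«A-0 AT THE PRINT-NORMALISED SETTING»); TAKES NO SIDE. abc-iut-c312-3 (gen 4)'s `Cor312ThetaBoxesDH` /
`Cor312PilotIdelesDH` (p419385/p420196, p419746) read the Θ-boxes and the `q`-centre of the assembled real setting off
pilot IDELES of `F` (Dupuy–Hilado arXiv:2004.13228 §3.7/§3.9, the SHARP reading `(𝒪_𝕃(−P_Θ))^{Ind3} := 𝒪_𝕃(−P_Θ)`) — for
abc-iut-c312-5's setting `Real.settingDHVol`, whose container `Real.summandPiecesDH` is not packet-normalised
(abc-iut-c312-1 gen 5, F-c312-1-g5-1: constant weight `1/[F:ℚ]^{j+1}` of [IUTchIII] Rmk. 3.1.1 (ii) p. 94 × NORMALISED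
`log μ̄` of [IUTchIV] Prop. 1.4 (i) p. 13; kernel certificate `Real.logvol_p_mul_DH`). THIS file is the twin over
abc-iut-c312-1's packet-normalised setting `Real.settingPrVol` (`Cor312SettingPrVol` p419741; probability weights
`Pr(v⃗) = Π_a n_{v_a}/[F:ℚ]^{j+1}`, Dupuy–Hilado §3.6), re-using abc-iut-c312-3's weight-free DEFINITIONS by name
(`thetaBoxDH`, `sharpBoxDH`, `labelIdele`, `qCentreDH`; the boxes, centres and field factors do not read the weights):

* §0 the DH box family at the packet-normalised setting: `thetaRegion3_thetaBoxDH_Pr` (= `e⁻¹(box)`),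
  `adm_thetaRegion3_thetaBoxDH_Pr` (`hθ` for admissible summand regions), `logvol_thetaRegion3_thetaBoxDH_Pr_inr`
  (`= Σ_{v⃗} Pr(v⃗)·log μ̄_{v⃗}(B_{v⃗})` — [IUTchIII] Rmk. 3.1.1 (ii)/(iii) with THE PROBABILITY WEIGHTS), finite support;
* §1 the SHARP boxes `ι_j(t_{Θ,j,v_j})·(R_I)^∼`: `adm_thetaRegion3_sharp_Pr`, **`logvol_thetaRegion3_sharp_Pr_inr`
  `= Σ_{v⃗} Pr(v⃗)·log ‖t_{Θ,i+1,v_{i+1}}‖`** (Dupuy–Hilado (3.7)), `finite_support_logvol_thetaRegion3_sharp_Pr`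
  (support ⊆ the primes under `S` for Θ-ideles that are units off `S`);
* §2 the `q`-centre: **`logvol_qRegion_Pr_inr = Σ_{v⃗} Pr(v⃗)·log ‖t_{q,v_j}‖`**, `finite_support_logvol_qRegion_Pr`;
* §3 **`settingPrVolSharp`** := `settingPrVol` with EVERY pilot binder supplied from ideles, `settingPrVolSharp_n`, and
  **`bridgeHyps_settingPrVolSharp`**: abc-iut-c312-6's `BridgeHyps` from `ThetaFinite` ALONE (`mono`/`image_adm`/
  `image_fin`/`hul_nonempty`/`theta_nonempty` by abc-iut-c312-1's `bridgeHyps_settingPrVol`, `hθ`/`hfinθ`/`hq`/`hfin` here).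
Companions: `Cor312ThetaFinitePrVol` (`ThetaFinite` from three box conditions), `Cor312PilotIdelesPrNumbers` (the
NUMBER `−|log(q)| = −deĝ(P_q)` here). [claim: Mochizuki2012, status: disputed] for the quoted setting; [cite: DupuyHilado2025,
Def. 3.6.1, §3.6, §3.7, §3.9, §4.10]; [cite: Mochizuki2012, IUTchIII Rmk. 3.1.1 (ii)(iii) p. 94–96, Prop. 3.9 (iii) p. 115].
HONEST FRAMING: nothing here asserts that Cor. 3.12 holds, nor that the sharp reading is the author's; realising ideles =
an arithmetic condition on the pilot data (abc-iut-c312-3 `exists_realising_thetaIdeles`). An instance ≠ an endorsement.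
-/

noncomputable section

open Set Function NumberField IsDedekindDomain
open scoped Pointwise

namespace Summit.ABC

namespace IUTFork

namespace Thm311

namespace Real

open Cor312 Cor312Vol Literature.IUT.LogThetaLattice Literature.IUT.LogVolume

variable {F : Type} [Field F] [NumberField F] (X : PilotData F) {logv : PadicLogs F} (hlog : LogvAnalytic logv)

variable (M : Type) [Field M] [NumberField M]
  (archPk : ∀ (j : (thetaIndex X).Label) (vQ : (thetaIndex X).VQ), Set ((logShellsDH X logv).Packet j vQ))
  (archSub : ∀ (j : (thetaIndex X).Label) (v : (thetaIndex X).V),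
    Set ((logShellsDH X logv).Packet j ((thetaIndex X).over v)))
  (Ψ : ℤ → ∀ v : (thetaIndex X).V, v ∈ (thetaIndex X).Vbad → Set ((logShellsDH X logv).StarPacket v))
  (act : ℤ → ∀ v : (thetaIndex X).V, v ∈ (thetaIndex X).Vbad →
    (logShellsDH X logv).StarPacket v → Module.End ℚ ((logShellsDH X logv).StarPacket v))
  (Mmod : ℤ → ∀ j : (thetaIndex X).LabelStar, Set ((logShellsDH X logv).GlobalPacket j.1))
  (region : ℤ → ∀ j : (thetaIndex X).LabelStar, FinDivisor M → ∀ vQ : (thetaIndex X).VQ,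
    Set ((logShellsDH X logv).Packet j.1 vQ))
  (n : ℤ) {HT : Type} {LogLink : HT → HT → Type} {IsFull : ∀ {s t : HT}, LogLink s t → Prop}
  (lat : LGPGaussianLogThetaLattice LogLink IsFull)
  {Frd : Type} {IsoF : Frd → Frd → Type} {Ob : Frd → Type} {realify : Frd → Frd} {Strip : Type}
  {IsoS : Strip → Strip → Type} {Mv : ∀ v : (thetaIndex X).V, v ∈ (thetaIndex X).Vbad → Type}
  [∀ v h, Monoid (Mv v h)]
  (sig : GlobalLGPFrobenioidSignature (thetaIndex X).lstar (thetaIndex X).V (· ∈ (thetaIndex X).Vbad)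
    Frd IsoF Ob realify Strip IsoS Mv)
  (split : SplittingMonoids Mv) {ObΔ : Type} {N : ∀ v : (thetaIndex X).V, v ∈ (thetaIndex X).Vbad → Type}
  [∀ v h, Monoid (N v h)] (qData : QPilotData ObΔ N)
  (qCentre : ObΔ → ∀ (j : (thetaIndex X).Label) (vQ : (thetaIndex X).VQ),
    ∀ s : factorIdxDH X hlog j vQ, factorFieldDH X hlog j vQ s)
  (hq : ∀ j vQ s, qCentre (qPilotObject qData) j vQ s ≠ 0)
  (hfin : ∀ j : (thetaIndex X).Label, (Function.support fun vQ =>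
    ((situationPrVol X hlog M archPk archSub Ψ act Mmod region).D n).logvol j vQ
      (factorMapDH X hlog j vQ ⁻¹' hullSet (factorFieldDH X hlog j vQ) (qCentre (qPilotObject qData) j vQ))).Finite)

/-! ## §0. The Dupuy–Hilado box family at the packet-normalised setting -/

section Boxes

variable (B : ∀ (pp : Nat.Primes) (j : (thetaIndex X).Label)
    (e : (thetaIndex X).Caps j → (thetaIndex X).Fibre (.inr pp)),
    haveI : Fact (pp : ℕ).Prime := ⟨pp.2⟩; Set ((presAt X hlog pp).X e))

/-- The log-volume of the packet-normalised container at the archimedean place is `0` on every region (the trivial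
archimedean container of abc-iut-c312-5's `Cor312VolumesRealAssembly`, kept by abc-iut-c312-1's `localPiecesPr`; the
honest archimedean twin is `Thm311RealDegreeArch`). [folklore] -/
theorem logvol_situationPrVol_inl (u : Unit) (j : (thetaIndex X).Label)
    (A : Set ((logShellsDH X logv).Packet j (.inl u))) :
    ((situationPrVol X hlog M archPk archSub Ψ act Mmod region).D n).logvol j (.inl u) A = 0 := by
  show ∑ e, (summandPiecesPr X hlog).w j (.inl u) e * _ = 0
  exact Finset.sum_eq_zero fun e _ => by
    rw [show (summandPiecesPr X hlog).w j (.inl u) e = 0 from rfl, zero_mul]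

/-- In the packet-normalised setting with the DH boxes, the (Ind3)-enlarged Θ-region `⋃ₘ thetaRegion m` IS the
preimage of the single box (the boxes do not depend on `m`, Dupuy–Hilado §4.10). [cite: DupuyHilado2025, §4.10] -/
theorem thetaRegion3_thetaBoxDH_Pr (j : (thetaIndex X).Label) (vQ : (thetaIndex X).VQ) :
    (settingPrVol X hlog M archPk archSub Ψ act Mmod region n lat sig split qData
        (fun _ _ => thetaBoxDH X hlog B) qCentre hq hfin).thetaRegion3 j vQ =
      factorMapDH X hlog j vQ ⁻¹' thetaBoxDH X hlog B j vQ := by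
  ext x
  rw [Setting.thetaRegion3, Set.mem_iUnion]
  exact ⟨fun ⟨_, h⟩ => h, fun h => ⟨0, h⟩⟩

/-- **`hθ` for the DH boxes at the packet-normalised setting**: if every summand region `B_{p,j,v⃗}` has positive
finite Haar measure, the (Ind3)-enlarged Θ-region is ADMISSIBLE in the packet-normalised container at every
`(j, v_ℚ)` (admissibility does not read the weights). [claim: Mochizuki2012, status: disputed] -/
theorem adm_thetaRegion3_thetaBoxDH_Pr
    (hB : ∀ (pp : Nat.Primes) (j : (thetaIndex X).Label)
      (e : (thetaIndex X).Caps j → (thetaIndex X).Fibre (.inr pp)),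
      haveI : Fact (pp : ℕ).Prime := ⟨pp.2⟩; PacketAdm pp.1 ((presAt X hlog pp).kk e) (B pp j e))
    (j : (thetaIndex X).Label) (vQ : (thetaIndex X).VQ) :
    ((situationPrVol X hlog M archPk archSub Ψ act Mmod region).D n).Adm j vQ
      ((settingPrVol X hlog M archPk archSub Ψ act Mmod region n lat sig split qData
        (fun _ _ => thetaBoxDH X hlog B) qCentre hq hfin).thetaRegion3 j vQ) := by
  rw [thetaRegion3_thetaBoxDH_Pr]
  cases vQ with
  | inl u =>
    refine (LocalPieces.adm_trivial_iff (logShellsDH X logv) (.inl u) j _).2 ⟨0, ?_⟩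
    exact Set.mem_univ _
  | inr pp =>
    haveI : Fact (pp : ℕ).Prime := ⟨pp.2⟩
    exact (presAtPr X hlog pp).adm_preimage_boxOf (hB pp j)

/-- **The log-volume of the (Ind3)-enlarged Θ-region at a prime, packet-normalised**: the weighted sum
`Σ_{v⃗} Pr(v⃗)·log μ̄_{v⃗}(B_{p,j,v⃗})` over the summands with the PROBABILITY weights ([IUTchIII] Rmk. 3.1.1 (ii), p. 94;
Dupuy–Hilado §3.6 `𝔼(log μ̄_{v⃗}(−))`). [claim: Mochizuki2012, status: disputed] -/
theorem logvol_thetaRegion3_thetaBoxDH_Pr_inr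
    (hB : ∀ (pp : Nat.Primes) (j : (thetaIndex X).Label)
      (e : (thetaIndex X).Caps j → (thetaIndex X).Fibre (.inr pp)),
      haveI : Fact (pp : ℕ).Prime := ⟨pp.2⟩; PacketAdm pp.1 ((presAt X hlog pp).kk e) (B pp j e))
    (j : (thetaIndex X).Label) (pp : Nat.Primes) :
    ((situationPrVol X hlog M archPk archSub Ψ act Mmod region).D n).logvol j (.inr pp)
      ((settingPrVol X hlog M archPk archSub Ψ act Mmod region n lat sig split qData
        (fun _ _ => thetaBoxDH X hlog B) qCentre hq hfin).thetaRegion3 j (.inr pp)) =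
      haveI : Fact (pp : ℕ).Prime := ⟨pp.2⟩
      ∑ e : (presAt X hlog pp).toLocalPieces.E j,
        weightPr X pp.1 j e * packetLogμ pp.1 ((presAt X hlog pp).kk e) (B pp j e) := by
  haveI : Fact (pp : ℕ).Prime := ⟨pp.2⟩
  rw [thetaRegion3_thetaBoxDH_Pr]
  have h := (presAtPr X hlog pp).factorMap_preimage_boxOf (B pp j)
  have key := SummandPieces.logvol_preimage_pi (summandPiecesPr X hlog) j (.inr pp) (R := B pp j) (hB pp j)
  change (summandPiecesPr X hlog).logvol j (.inr pp)
    ((fun x => (presAtPr X hlog pp).factorMap j x) ⁻¹' (presAtPr X hlog pp).boxOf (B pp j)) = _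
  rw [h]
  exact key

/-- The support of `v_ℚ ↦ log-volume of the (Ind3)-enlarged Θ-region at (j, v_ℚ)` lies among the primes carrying a
summand of non-zero log-measure (any weights). [folklore] -/
theorem support_logvol_thetaRegion3_thetaBoxDH_Pr_subset
    (hB : ∀ (pp : Nat.Primes) (j : (thetaIndex X).Label)
      (e : (thetaIndex X).Caps j → (thetaIndex X).Fibre (.inr pp)),
      haveI : Fact (pp : ℕ).Prime := ⟨pp.2⟩; PacketAdm pp.1 ((presAt X hlog pp).kk e) (B pp j e))
    (j : (thetaIndex X).Label) :
    (Function.support fun vQ =>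
      ((situationPrVol X hlog M archPk archSub Ψ act Mmod region).D n).logvol j vQ
        ((settingPrVol X hlog M archPk archSub Ψ act Mmod region n lat sig split qData
          (fun _ _ => thetaBoxDH X hlog B) qCentre hq hfin).thetaRegion3 j vQ)) ⊆
      Sum.inr '' {pp : Nat.Primes | haveI : Fact (pp : ℕ).Prime := ⟨pp.2⟩;
        ∃ e : (thetaIndex X).Caps j → (thetaIndex X).Fibre (.inr pp),
          packetLogμ pp.1 ((presAt X hlog pp).kk e) (B pp j e) ≠ 0} := by
  intro vQ hvQ
  rw [Function.mem_support] at hvQ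
  cases vQ with
  | inl u => exact absurd (logvol_situationPrVol_inl X hlog M archPk archSub Ψ act Mmod region n u j _) hvQ
  | inr pp =>
    refine ⟨pp, ?_, rfl⟩
    haveI : Fact (pp : ℕ).Prime := ⟨pp.2⟩
    by_contra hall
    simp only [Set.mem_setOf_eq, not_exists, not_not] at hall
    apply hvQ
    rw [logvol_thetaRegion3_thetaBoxDH_Pr_inr X hlog M archPk archSub Ψ act Mmod region n lat sig split qData
      qCentre hq hfin B hB j pp]
    exact Finset.sum_eq_zero fun e _ => by rw [hall e, mul_zero]

/-- **`hfinθ` for the DH boxes at the packet-normalised setting**: if only finitely many primes carry a summand region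
of non-zero log-measure at the label `j`, the log-volume of the (Ind3)-enlarged Θ-region at `j` is finitely supported
over `V_ℚ` ([IUTchIII] Prop. 3.9 (iii)). [claim: Mochizuki2012, status: disputed] -/
theorem finite_support_logvol_thetaRegion3_thetaBoxDH_Pr
    (hB : ∀ (pp : Nat.Primes) (j : (thetaIndex X).Label)
      (e : (thetaIndex X).Caps j → (thetaIndex X).Fibre (.inr pp)),
      haveI : Fact (pp : ℕ).Prime := ⟨pp.2⟩; PacketAdm pp.1 ((presAt X hlog pp).kk e) (B pp j e))
    (j : (thetaIndex X).Label)
    (hB0 : {pp : Nat.Primes | haveI : Fact (pp : ℕ).Prime := ⟨pp.2⟩;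
      ∃ e : (thetaIndex X).Caps j → (thetaIndex X).Fibre (.inr pp),
        packetLogμ pp.1 ((presAt X hlog pp).kk e) (B pp j e) ≠ 0}.Finite) :
    (Function.support fun vQ =>
      ((situationPrVol X hlog M archPk archSub Ψ act Mmod region).D n).logvol j vQ
        ((settingPrVol X hlog M archPk archSub Ψ act Mmod region n lat sig split qData
          (fun _ _ => thetaBoxDH X hlog B) qCentre hq hfin).thetaRegion3 j vQ)).Finite :=
  (hB0.image _).subset (support_logvol_thetaRegion3_thetaBoxDH_Pr_subset X hlog M archPk archSub Ψ act Mmod region n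
    lat sig split qData qCentre hq hfin B hB j)

end Boxes

/-! ## §1. The SHARP boxes `ι_j(t_{Θ,j,v_j})·(R_I)^∼` at the packet-normalised setting -/

section Sharp

variable (t : ∀ (pp : Nat.Primes) (_ : Fin X.lstar) (x : (thetaIndex X).Fibre (.inr pp)),
  haveI : Fact (pp : ℕ).Prime := ⟨pp.2⟩; kOf X pp.1 x)

/-- **`hθ` PROVED for the sharp Dupuy–Hilado boxes, packet-normalised container**: the (Ind3)-enlarged Θ-region of
the assembled setting is admissible at every `(j, v_ℚ)`. [claim: Mochizuki2012, status: disputed] -/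
theorem adm_thetaRegion3_sharp_Pr (ht0 : ∀ pp i x, t pp i x ≠ 0) (j : (thetaIndex X).Label)
    (vQ : (thetaIndex X).VQ) :
    ((situationPrVol X hlog M archPk archSub Ψ act Mmod region).D n).Adm j vQ
      ((settingPrVol X hlog M archPk archSub Ψ act Mmod region n lat sig split qData
        (fun _ _ => thetaBoxDH X hlog (sharpBoxDH X hlog t)) qCentre hq hfin).thetaRegion3 j vQ) :=
  adm_thetaRegion3_thetaBoxDH_Pr X hlog M archPk archSub Ψ act Mmod region n lat sig split qData qCentre hq hfin
    (sharpBoxDH X hlog t) (packetAdm_sharpBoxDH X hlog t ht0) j vQ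

/-- **The log-volume of the sharp (Ind3)-region at `(i+1, p)`, packet-normalised**, is
`Σ_{v⃗} Pr(v⃗)·log ‖t_{Θ,i+1,v_{i+1}}‖` (Dupuy–Hilado (3.7) summand by summand, weighted by `Pr(v⃗)`; the expectation
form `Σ_{v|p} (n_v/[F:ℚ])·log ‖t_{Θ,i+1,v}‖` is in the companion `Cor312PilotIdelesPrNumbers`).
[cite: DupuyHilado2025, §3.6, §3.7, §3.9] -/
theorem logvol_thetaRegion3_sharp_Pr_inr (ht0 : ∀ pp i x, t pp i x ≠ 0) (i : Fin (thetaIndex X).lstar)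
    (pp : Nat.Primes) :
    ((situationPrVol X hlog M archPk archSub Ψ act Mmod region).D n).logvol (Setting.labelSucc i) (.inr pp)
      ((settingPrVol X hlog M archPk archSub Ψ act Mmod region n lat sig split qData
        (fun _ _ => thetaBoxDH X hlog (sharpBoxDH X hlog t)) qCentre hq hfin).thetaRegion3
          (Setting.labelSucc i) (.inr pp)) =
      haveI : Fact (pp : ℕ).Prime := ⟨pp.2⟩
      ∑ e : (presAt X hlog pp).toLocalPieces.E (Setting.labelSucc i),
        weightPr X pp.1 (Setting.labelSucc i) e * Real.log ‖t pp i (e (Fin.last _))‖ := by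
  haveI : Fact (pp : ℕ).Prime := ⟨pp.2⟩
  rw [logvol_thetaRegion3_thetaBoxDH_Pr_inr X hlog M archPk archSub Ψ act Mmod region n lat sig split qData qCentre hq
    hfin (sharpBoxDH X hlog t) (packetAdm_sharpBoxDH X hlog t ht0)]
  refine Finset.sum_congr rfl fun e _ => ?_
  rw [packetLogμ_sharpBoxDH X hlog t ht0, labelIdele_labelSucc]

/-- **`hfinθ` PROVED for the sharp Dupuy–Hilado boxes, packet-normalised container**: for Θ-ideles that are units off
`S` (e.g. realising `P_Θ`, abc-iut-c312-3 `norm_eq_one_of_realises`), the log-volume of the (Ind3)-enlarged Θ-region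
at every label `j = i+1` is supported on the (finitely many) primes under `S`. [claim: Mochizuki2012, status: disputed] -/
theorem finite_support_logvol_thetaRegion3_sharp_Pr (ht0 : ∀ pp i x, t pp i x ≠ 0)
    (ht1 : ∀ (pp : Nat.Primes) (i : Fin X.lstar) (x : (thetaIndex X).Fibre (.inr pp)),
      haveI : Fact (pp : ℕ).Prime := ⟨pp.2⟩; placeOf X pp.1 x ∉ X.S → ‖t pp i x‖ = 1)
    (i : Fin (thetaIndex X).lstar) :
    (Function.support fun vQ : (thetaIndex X).VQ =>
      ((situationPrVol X hlog M archPk archSub Ψ act Mmod region).D n).logvol _ vQ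
        ((settingPrVol X hlog M archPk archSub Ψ act Mmod region n lat sig split qData
          (fun _ _ => thetaBoxDH X hlog (sharpBoxDH X hlog t)) qCentre hq hfin).thetaRegion3
            (Setting.labelSucc i) vQ)).Finite := by
  refine finite_support_logvol_thetaRegion3_thetaBoxDH_Pr X hlog M archPk archSub Ψ act Mmod region n lat sig split
    qData qCentre hq hfin (sharpBoxDH X hlog t) (packetAdm_sharpBoxDH X hlog t ht0) (Setting.labelSucc i)
    ((finite_primes_under_S X).subset ?_)
  rintro pp ⟨e, he⟩
  haveI : Fact (pp : ℕ).Prime := ⟨pp.2⟩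
  rw [packetLogμ_sharpBoxDH X hlog t ht0, labelIdele_labelSucc] at he
  by_contra hpp
  have hx : placeOf X pp.1 (e (Fin.last _)) ∉ X.S := fun hS => hpp ⟨_, hS, natCast_mem_placeOf X pp.1 _⟩
  exact he (by rw [ht1 pp i _ hx, Real.log_one])

end Sharp

/-! ## §2. The `q`-centre read off `q`-pilot ideles; §3. the setting with every pilot binder supplied -/

section QCentre

variable (tq : ∀ (pp : Nat.Primes) (x : (thetaIndex X).Fibre (.inr pp)),
  haveI : Fact (pp : ℕ).Prime := ⟨pp.2⟩; kOf X pp.1 x)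

/-- **The log-volume of the `q`-pilot region at a prime, packet-normalised**, is `Σ_{v⃗} Pr(v⃗)·log ‖t_{q,v_j}‖` (the
hull-set `λ_q·𝒪_L` of abc-iut-c312-3's `qCentreDH` pulls back to `Π_{v⃗} ι_j(t_{q,v_j})·(R_I)^∼`, Dupuy–Hilado §3.9;
(3.7) summand by summand). [cite: DupuyHilado2025, §3.6, §3.7, §3.9] -/
theorem logvol_qRegion_Pr_inr (htq0 : ∀ pp x, tq pp x ≠ 0) (j : (thetaIndex X).Label) (pp : Nat.Primes) :
    ((situationPrVol X hlog M archPk archSub Ψ act Mmod region).D n).logvol j (.inr pp)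
      (factorMapDH X hlog j (.inr pp) ⁻¹' hullSet (factorFieldDH X hlog j (.inr pp))
        (qCentreDH X hlog tq j (.inr pp))) =
      haveI : Fact (pp : ℕ).Prime := ⟨pp.2⟩
      ∑ e : (presAt X hlog pp).toLocalPieces.E j, weightPr X pp.1 j e * Real.log ‖tq pp (e (Fin.last _))‖ := by
  haveI : Fact (pp : ℕ).Prime := ⟨pp.2⟩
  haveI : Nonempty ((thetaIndex X).Caps j) := ⟨0⟩
  have hg : ∀ (e : (thetaIndex X).Caps j → (thetaIndex X).Fibre (.inr pp)) (i : DIdx pp.1 ((presAtPr X hlog pp).kk e)),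
      dEquiv pp.1 ((presAtPr X hlog pp).kk e)
        (iota pp.1 ((presAtPr X hlog pp).kk e) (Fin.last _) (tq pp (e (Fin.last _)))) i ≠ 0 :=
    fun e i => dEquiv_iota_ne_zero pp.1 _ (Fin.last _) (htq0 pp _) i
  have h := (presAtPr X hlog pp).factorMap_preimage_hullSet_centreOf
    (fun e => iota pp.1 ((presAtPr X hlog pp).kk e) (Fin.last _) (tq pp (e (Fin.last _)))) hg
  have hadm : ∀ e : (thetaIndex X).Caps j → (thetaIndex X).Fibre (.inr pp),
      PacketAdm pp.1 ((presAtPr X hlog pp).kk e)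
        (iota pp.1 ((presAtPr X hlog pp).kk e) (Fin.last _) (tq pp (e (Fin.last _))) •
          (normalizedPacket pp.1 ((presAtPr X hlog pp).kk e) : Set ((presAtPr X hlog pp).X e))) :=
    fun e => packetAdm_iota_smul pp.1 _ (Fin.last _) (htq0 pp _) (packetAdm_normalizedPacket pp.1 _)
  have key := SummandPieces.logvol_preimage_pi (summandPiecesPr X hlog) j (.inr pp) hadm
  change (summandPiecesPr X hlog).logvol j (.inr pp)
    ((fun x => (presAtPr X hlog pp).factorMap j x) ⁻¹'
      hullSet ((presAtPr X hlog pp).factorField j) ((presAtPr X hlog pp).centreOf fun e =>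
        iota pp.1 ((presAtPr X hlog pp).kk e) (Fin.last _) (tq pp (e (Fin.last _))))) = _
  rw [h]
  refine key.trans (Finset.sum_congr rfl fun e _ => ?_)
  show weightPr X pp.1 j e * packetLogμ pp.1 ((presAtPr X hlog pp).kk e) _ = _
  rw [packetLogμ_iota_smul_normalizedPacket pp.1 _ (Fin.last _) (htq0 pp _)]
  rfl

/-- The support of `v_ℚ ↦ log-volume of the q-pilot region at (j, v_ℚ)` lies among the primes under `S`, for
`q`-ideles that are units off `S` (any weights). [folklore] -/
theorem support_logvol_qRegion_Pr_subset (htq0 : ∀ pp x, tq pp x ≠ 0)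
    (htq1 : ∀ (pp : Nat.Primes) (x : (thetaIndex X).Fibre (.inr pp)),
      haveI : Fact (pp : ℕ).Prime := ⟨pp.2⟩; placeOf X pp.1 x ∉ X.S → ‖tq pp x‖ = 1)
    (j : (thetaIndex X).Label) :
    (Function.support fun vQ => ((situationPrVol X hlog M archPk archSub Ψ act Mmod region).D n).logvol j vQ
      (factorMapDH X hlog j vQ ⁻¹' hullSet (factorFieldDH X hlog j vQ) (qCentreDH X hlog tq j vQ))) ⊆
      Sum.inr '' {pp : Nat.Primes | ∃ v ∈ X.S, ((pp : ℕ) : 𝓞 F) ∈ v.asIdeal} := by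
  intro vQ hvQ
  rw [Function.mem_support] at hvQ
  cases vQ with
  | inl u => exact absurd (logvol_situationPrVol_inl X hlog M archPk archSub Ψ act Mmod region n u j _) hvQ
  | inr pp =>
    refine ⟨pp, ?_, rfl⟩
    haveI : Fact (pp : ℕ).Prime := ⟨pp.2⟩
    by_contra hpp
    apply hvQ
    rw [logvol_qRegion_Pr_inr X hlog M archPk archSub Ψ act Mmod region n tq htq0 j pp]
    refine Finset.sum_eq_zero fun e _ => ?_
    have hx : placeOf X pp.1 (e (Fin.last _)) ∉ X.S := fun hS => hpp ⟨_, hS, natCast_mem_placeOf X pp.1 _⟩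
    rw [htq1 pp _ hx, Real.log_one, mul_zero]

/-- **`hfin` PROVED, packet-normalised**: for `q`-ideles that are units off `S` (e.g. realising `P_q`), the log-volume
of the `q`-pilot region at every label is supported on the (finitely many) primes under `S` ([IUTchIII] Prop. 3.9
(iii)). [claim: Mochizuki2012, status: disputed] -/
theorem finite_support_logvol_qRegion_Pr (htq0 : ∀ pp x, tq pp x ≠ 0)
    (htq1 : ∀ (pp : Nat.Primes) (x : (thetaIndex X).Fibre (.inr pp)),
      haveI : Fact (pp : ℕ).Prime := ⟨pp.2⟩; placeOf X pp.1 x ∉ X.S → ‖tq pp x‖ = 1)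
    (j : (thetaIndex X).Label) :
    (Function.support fun vQ => ((situationPrVol X hlog M archPk archSub Ψ act Mmod region).D n).logvol j vQ
      (factorMapDH X hlog j vQ ⁻¹' hullSet (factorFieldDH X hlog j vQ) (qCentreDH X hlog tq j vQ))).Finite :=
  ((finite_primes_under_S X).image _).subset
    (support_logvol_qRegion_Pr_subset X hlog M archPk archSub Ψ act Mmod region n tq htq0 htq1 j)

/-- **The setting of [IUTchIII] Cor. 3.12 over the REAL log-shells of `F` with the PACKET-NORMALISED verbatim volumes
and the Dupuy–Hilado PILOT REGIONS READ OFF IDELES** (sharp reading): abc-iut-c312-1's `settingPrVol` with the Θ-boxes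
`ι_j(t_{Θ,j,v_j})·(R_I)^∼`, the `q`-centre `ψ(ι_j(t_{q,v_j}))`, `hq` and `hfin` SUPPLIED — the print-normalised twin of
abc-iut-c312-3's `settingDHVolSharp`. Binders left: the column `n`, the context data `lat`/`sig`/`split`/`qData`, the
archimedean structures and (b)(c) data of the situation, and the ideles `t`, `tq` (non-zero; `tq` units off `S`).
[claim: Mochizuki2012, status: disputed] -/
def settingPrVolSharp
    (t : ∀ (pp : Nat.Primes) (_ : Fin X.lstar) (x : (thetaIndex X).Fibre (.inr pp)),
      haveI : Fact (pp : ℕ).Prime := ⟨pp.2⟩; kOf X pp.1 x)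
    (htq0 : ∀ pp x, tq pp x ≠ 0)
    (htq1 : ∀ (pp : Nat.Primes) (x : (thetaIndex X).Fibre (.inr pp)),
      haveI : Fact (pp : ℕ).Prime := ⟨pp.2⟩; placeOf X pp.1 x ∉ X.S → ‖tq pp x‖ = 1) :
    Cor312.Setting (situationPrVol X hlog M archPk archSub Ψ act Mmod region) :=
  settingPrVol X hlog M archPk archSub Ψ act Mmod region n lat sig split qData
    (fun _ _ => thetaBoxDH X hlog (sharpBoxDH X hlog t)) (fun _ => qCentreDH X hlog tq)
    (qCentreDH_ne_zero X hlog tq htq0)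
    (finite_support_logvol_qRegion_Pr X hlog M archPk archSub Ψ act Mmod region n tq htq0 htq1)

/-- The column of `settingPrVolSharp` is `n`. [folklore] -/
theorem settingPrVolSharp_n
    (t : ∀ (pp : Nat.Primes) (_ : Fin X.lstar) (x : (thetaIndex X).Fibre (.inr pp)),
      haveI : Fact (pp : ℕ).Prime := ⟨pp.2⟩; kOf X pp.1 x)
    (htq0 : ∀ pp x, tq pp x ≠ 0)
    (htq1 : ∀ (pp : Nat.Primes) (x : (thetaIndex X).Fibre (.inr pp)),
      haveI : Fact (pp : ℕ).Prime := ⟨pp.2⟩; placeOf X pp.1 x ∉ X.S → ‖tq pp x‖ = 1) :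
    (settingPrVolSharp X hlog M archPk archSub Ψ act Mmod region n lat sig split qData tq t htq0 htq1).n = n :=
  rfl

/-- **abc-iut-c312-6's `BridgeHyps` for the packet-normalised real setting with the sharp Dupuy–Hilado pilot regions,
from `ThetaFinite` ALONE**: `mono`, `image_adm`, `image_fin`, `hul_nonempty`, `theta_nonempty` (abc-iut-c312-1
`bridgeHyps_settingPrVol`) and `hθ`, `hfinθ` (§1) are DISCHARGED for Θ-ideles that are units off `S`; the remaining input
`ThetaFinite` ("`−|log(Θ)| ∈ ℝ`") is this seat's `thetaFinite_settingPrVol` (`Cor312ThetaFinitePrVol`), discharged for the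
sharp boxes in the companion capstone. [claim: Mochizuki2012, status: disputed] -/
theorem bridgeHyps_settingPrVolSharp
    (t : ∀ (pp : Nat.Primes) (_ : Fin X.lstar) (x : (thetaIndex X).Fibre (.inr pp)),
      haveI : Fact (pp : ℕ).Prime := ⟨pp.2⟩; kOf X pp.1 x)
    (ht0 : ∀ pp i x, t pp i x ≠ 0)
    (ht1 : ∀ (pp : Nat.Primes) (i : Fin X.lstar) (x : (thetaIndex X).Fibre (.inr pp)),
      haveI : Fact (pp : ℕ).Prime := ⟨pp.2⟩; placeOf X pp.1 x ∉ X.S → ‖t pp i x‖ = 1)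
    (htq0 : ∀ pp x, tq pp x ≠ 0)
    (htq1 : ∀ (pp : Nat.Primes) (x : (thetaIndex X).Fibre (.inr pp)),
      haveI : Fact (pp : ℕ).Prime := ⟨pp.2⟩; placeOf X pp.1 x ∉ X.S → ‖tq pp x‖ = 1)
    (finite : (settingPrVolSharp X hlog M archPk archSub Ψ act Mmod region n lat sig split qData tq t htq0
      htq1).ThetaFinite) :
    BridgeHyps (settingPrVolSharp X hlog M archPk archSub Ψ act Mmod region n lat sig split qData tq t htq0
      htq1) :=
  bridgeHyps_settingPrVol X hlog M archPk archSub Ψ act Mmod region n lat sig split qData _ _ _ _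
    (fun _ vQ => adm_thetaRegion3_sharp_Pr X hlog M archPk archSub Ψ act Mmod region n lat sig split qData _ _ _ t ht0
      _ vQ)
    (fun i => finite_support_logvol_thetaRegion3_sharp_Pr X hlog M archPk archSub Ψ act Mmod region n lat sig split
      qData _ _ _ t ht0 ht1 i)
    finite

end QCentre

end Real

end Thm311

end IUTFork

end Summit.ABC

end
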